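import Literature.NumberTheory.QuadraticFields.ReducedForms
import Mathlib.RingTheory.Coprime.Lemmas
import Mathlib.Data.Nat.Factorization.Induction
import Mathlib.Tactic
import HarnessLib

/-!
# Reduced forms with a prescribed first coefficient: Lenstra–Pomerance 1992, Lemma 2.10

H. W. Lenstra Jr. and C. Pomerance, *A rigorous time bound for factoring integers*,
J. Amer. Math. Soc. **5** (1992) 483–516, §2, (2.6)–(2.9) and **Lemma 2.10** (p. 489):

> Let `a` be an integer with `1 ≤ a ≤ ½√|Δ|` all of whose prime factors belong to `𝒫_Δ`. Then
> there exist `b, c ∈ ℤ` such that `(a, b, c) ∈ C_Δ`.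

Here `Δ` is a negative discriminant, `C_Δ` is the set of reduced primitive positive definite forms
of discriminant `Δ` (the tree's `reducedForms Δ`, file `ReducedForms.lean`), and
`𝒫_Δ = {p prime : (Δ/p) = 1}` ((2.7), Kronecker symbol (2.6)): for an odd prime `p` this says
`p ∤ Δ` and `Δ` is a square modulo `p`; for `p = 2` it says `Δ ≡ 1 (mod 8)` ((2.6)–(2.7): "if `p`
is even, then `p ∈ 𝒫_Δ` if and only if `Δ ≡ 1 mod 8`"). The hypotheses `h2`, `hodd` of
`exists_mem_reducedForms_fst_eq` spell this out, and `a ≤ ½√|Δ|` is written `4a² ≤ |Δ|`.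

The printed proof: "Since all prime factors of `a` belong to `𝒫_Δ`, there exists `b ∈ ℤ` with
`b² ≡ Δ mod 4a`; note that `gcd(a, b) = 1` for any such `b`. Adding multiples of `2a` to `b` we can
achieve that `-a < b ≤ a`. The integer `c = (b² - Δ)/(4a)` satisfies `4ac = b² + |Δ| ≥ |Δ| ≥ 4a²`,
and equality is possible only if `b = 0`. It follows that (2.1) and (2.2) hold." The first
sentence is the local–global principle for square roots modulo `4a` (Hensel lifting at the odd
primes, the `mod 8` lifting at `2`, and the Chinese remainder theorem), proved here from scratch
(`exists_sq_sub_dvd_prime_pow`, `exists_sq_sub_dvd_two_pow`, `exists_sq_sub_dvd_mul_of_coprime`,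
`exists_sq_sub_dvd_of_forall_primeFactors`, `exists_sq_sub_dvd_four_mul`).
Everything is proved; no definitions, no named facts.
-/

namespace Literature.NumberTheory.QuadraticFields.BinaryQuadraticForm

open Finset

/-! ### Square roots modulo `n`: Chinese remainder theorem and Hensel lifting -/

/-- **CRT for square roots**: if `Δ` is a square modulo the coprime `m` and `n`, it is a square
modulo `mn`. [folklore] -/
theorem exists_sq_sub_dvd_mul_of_coprime {m n : ℕ} (hmn : Nat.Coprime m n) {Δ : ℤ}
    (hm : ∃ x : ℤ, (m : ℤ) ∣ x ^ 2 - Δ) (hn : ∃ y : ℤ, (n : ℤ) ∣ y ^ 2 - Δ) :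
    ∃ z : ℤ, ((m * n : ℕ) : ℤ) ∣ z ^ 2 - Δ := by
  obtain ⟨x, hx⟩ := hm
  obtain ⟨y, hy⟩ := hn
  have hcop : IsCoprime (m : ℤ) (n : ℤ) := Nat.isCoprime_iff_coprime.2 hmn
  have hcop' := hcop
  obtain ⟨u, v, huv⟩ := hcop'
  set z : ℤ := y * u * m + x * v * n with hz
  have hzx : (m : ℤ) ∣ z - x := ⟨u * (y - x), by rw [hz]; linear_combination x * huv⟩
  have hzy : (n : ℤ) ∣ z - y := ⟨v * (x - y), by rw [hz]; linear_combination y * huv⟩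
  refine ⟨z, ?_⟩
  push_cast
  refine IsCoprime.mul_dvd hcop ?_ ?_
  · have := dvd_add hx (dvd_mul_of_dvd_left hzx (z + x))
    convert this using 1
    ring
  · have := dvd_add hy (dvd_mul_of_dvd_left hzy (z + y))
    convert this using 1
    ring

/-- For a prime `p` and an integer `a` with `p ∤ a`: `IsCoprime a p`. [folklore] -/
theorem isCoprime_of_prime_not_dvd {p : ℕ} (hp : p.Prime) {a : ℤ} (h : ¬ (p : ℤ) ∣ a) :
    IsCoprime a (p : ℤ) := by
  rw [Int.isCoprime_iff_gcd_eq_one, Int.gcd_eq_natAbs, Int.natAbs_natCast]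
  exact (Nat.Coprime.symm ((Nat.Prime.coprime_iff_not_dvd hp).2
    (fun h' => h (Int.natCast_dvd.2 h')))).gcd_eq_one

/-- **Hensel lifting at an odd prime**: if `p ∤ Δ` and `Δ` is a square modulo the odd prime `p`,
then `Δ` is a square modulo every power `p^k`. [folklore] -/
theorem exists_sq_sub_dvd_prime_pow {p : ℕ} (hp : p.Prime) (hp2 : p ≠ 2) {Δ : ℤ}
    (hΔ : ¬ (p : ℤ) ∣ Δ) (h1 : ∃ x : ℤ, (p : ℤ) ∣ x ^ 2 - Δ) (k : ℕ) :
    ∃ x : ℤ, ((p ^ k : ℕ) : ℤ) ∣ x ^ 2 - Δ := by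
  induction k with
  | zero => exact ⟨0, by simp⟩
  | succ k ih =>
    rcases k with _ | k
    · simpa using h1
    obtain ⟨x, m, hm⟩ := ih
    push_cast at hm
    have hprime : Prime (p : ℤ) := Nat.prime_iff_prime_int.1 hp
    have hpx : ¬ (p : ℤ) ∣ x := fun h => hΔ (by
      have h2 : (p : ℤ) ∣ x ^ 2 := dvd_pow h two_ne_zero
      have h3 : (p : ℤ) ∣ x ^ 2 - Δ := ⟨p ^ k * m, by rw [hm]; ring⟩
      simpa using dvd_sub h2 h3)
    have hp2x : ¬ (p : ℤ) ∣ 2 * x := by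
      intro h
      rcases hprime.dvd_or_dvd h with h | h
      · have : p ∣ 2 := Int.natCast_dvd_natCast.1 h
        exact hp2 ((Nat.prime_dvd_prime_iff_eq hp Nat.prime_two).1 this)
      · exact hpx h
    obtain ⟨u, v, huv⟩ := isCoprime_of_prime_not_dvd hp hp2x
    -- `u (2x) + v p = 1`; take `t = -u m`, so that `p ∣ m + 2 x t`
    refine ⟨x + -(u * m) * p ^ (k + 1), v * m + u ^ 2 * m ^ 2 * p ^ k, ?_⟩
    push_cast
    linear_combination hm - ((p : ℤ) ^ (k + 1) * m) * huv

/-- **Lifting at `2`**: if `Δ ≡ 1 (mod 8)` then `Δ` is a square of an odd number modulo every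
`2^e`. [folklore] -/
theorem exists_sq_sub_dvd_two_pow {Δ : ℤ} (hΔ : Δ % 8 = 1) (e : ℕ) :
    ∃ x : ℤ, ((2 ^ e : ℕ) : ℤ) ∣ x ^ 2 - Δ ∧ ¬ (2 : ℤ) ∣ x := by
  induction e with
  | zero => exact ⟨1, by simp, by omega⟩
  | succ e ih =>
    by_cases he : e + 1 ≤ 3
    · refine ⟨1, ?_, by omega⟩
      have h8 : (8 : ℤ) ∣ 1 ^ 2 - Δ := ⟨-(Δ / 8), by omega⟩
      refine dvd_trans ?_ h8
      push_cast
      have he2 : e ≤ 2 := by omega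
      interval_cases e <;> norm_num
    · obtain ⟨f, rfl⟩ : ∃ f, e = f + 3 := ⟨e - 3, by omega⟩
      obtain ⟨x, ⟨m, hm⟩, hx⟩ := ih
      push_cast at hm
      obtain ⟨y, rfl⟩ : ∃ y, x = 2 * y + 1 := ⟨x / 2, by omega⟩
      rcases Int.even_or_odd m with ⟨j, rfl⟩ | ⟨j, rfl⟩
      · refine ⟨2 * y + 1, ⟨j, ?_⟩, hx⟩
        push_cast
        linear_combination hm
      · refine ⟨2 * y + 1 + 2 ^ (f + 2), ⟨j + y + 1 + 2 ^ f, ?_⟩, ?_⟩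
        · push_cast
          linear_combination hm
        · rw [show (2 : ℤ) ^ (f + 2) = 2 ^ f * 2 * 2 by ring]
          omega

/-- **Square roots modulo an odd modulus from square roots modulo its primes**: if every prime
factor `p` of `m` is odd, does not divide `Δ`, and has `Δ` a square mod `p`, then `Δ` is a square
mod `m`. [folklore] -/
theorem exists_sq_sub_dvd_of_forall_primeFactors {m : ℕ} (hm0 : m ≠ 0) {Δ : ℤ}
    (h : ∀ p ∈ m.primeFactors, p ≠ 2 ∧ ¬ (p : ℤ) ∣ Δ ∧ ∃ x : ℤ, (p : ℤ) ∣ x ^ 2 - Δ) :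
    ∃ x : ℤ, (m : ℤ) ∣ x ^ 2 - Δ := by
  induction m using Nat.recOnPosPrimePosCoprime with
  | prime_pow p k hp hk =>
    obtain ⟨hp2, hpΔ, h1⟩ := h p (by
      rw [Nat.primeFactors_prime_pow hk.ne' hp]; exact Finset.mem_singleton_self p)
    exact exists_sq_sub_dvd_prime_pow hp hp2 hpΔ h1 k
  | zero => exact absurd rfl hm0
  | one => exact ⟨0, by simp⟩
  | coprime a b ha hb hab iha ihb =>
    have ha0 : a ≠ 0 := by omega
    have hb0 : b ≠ 0 := by omega
    refine exists_sq_sub_dvd_mul_of_coprime hab (iha ha0 fun p hp => h p ?_)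
      (ihb hb0 fun p hp => h p ?_)
    · rw [Nat.primeFactors_mul ha0 hb0]; exact Finset.mem_union_left _ hp
    · rw [Nat.primeFactors_mul ha0 hb0]; exact Finset.mem_union_right _ hp

/-- **`Δ` is a square modulo `4a`** when `Δ ≡ 0, 1 (mod 4)`, `Δ ≡ 1 (mod 8)` if `a` is even, and
every odd prime factor `p` of `a` has `p ∤ Δ`, `Δ` a square mod `p` — i.e. when all prime factors
of `a` lie in `𝒫_Δ` [LP92 (2.7)]: the first step of the proof of Lemma 2.10.
[cite: LenstraPomerance1992, §2 Lemma 2.10 (proof)] -/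
theorem exists_sq_sub_dvd_four_mul {Δ : ℤ} (h4 : Δ % 4 = 0 ∨ Δ % 4 = 1) {a : ℕ} (ha : 0 < a)
    (h2 : 2 ∣ a → Δ % 8 = 1)
    (hodd : ∀ p ∈ a.primeFactors, p ≠ 2 → ¬ (p : ℤ) ∣ Δ ∧ ∃ x : ℤ, (p : ℤ) ∣ x ^ 2 - Δ) :
    ∃ x : ℤ, ((4 * a : ℕ) : ℤ) ∣ x ^ 2 - Δ := by
  obtain ⟨v, m, hmodd, hav⟩ := Nat.exists_eq_two_pow_mul_odd ha.ne'
  have hm0 : m ≠ 0 := by rintro rfl; simp at hmodd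
  rw [Nat.odd_iff] at hmodd
  -- square root modulo the odd part `m`
  have hm : ∃ x : ℤ, (m : ℤ) ∣ x ^ 2 - Δ := by
    refine exists_sq_sub_dvd_of_forall_primeFactors hm0 fun p hp => ?_
    have hpa : p ∈ a.primeFactors := by
      rw [hav, Nat.primeFactors_mul (pow_ne_zero _ two_ne_zero) hm0]
      exact Finset.mem_union_right _ hp
    have hp2 : p ≠ 2 := by
      rintro rfl
      have := Nat.dvd_of_mem_primeFactors hp
      omega
    exact ⟨hp2, hodd p hpa hp2⟩
  -- square root modulo `2^(v+2)`
  have h2v : ∃ x : ℤ, ((2 ^ (v + 2) : ℕ) : ℤ) ∣ x ^ 2 - Δ := by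
    rcases Nat.eq_zero_or_pos v with rfl | hv
    · rcases h4 with h40 | h41
      · exact ⟨0, by push_cast; omega⟩
      · exact ⟨1, by push_cast; omega⟩
    · have h8 : Δ % 8 = 1 := h2 ⟨2 ^ (v - 1) * m, by
        rw [hav, ← mul_assoc, ← pow_succ']; congr 2; omega⟩
      obtain ⟨x, hx, -⟩ := exists_sq_sub_dvd_two_pow h8 (v + 2)
      exact ⟨x, hx⟩
  have hcop : Nat.Coprime (2 ^ (v + 2)) m :=
    Nat.Coprime.pow_left _ ((Nat.prime_two.coprime_iff_not_dvd).2 (by omega))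
  have h4a : 4 * a = 2 ^ (v + 2) * m := by rw [hav, pow_add]; ring
  rw [h4a]
  exact exists_sq_sub_dvd_mul_of_coprime hcop h2v hm

/-! ### Lemma 2.10 -/

/-- **Lenstra–Pomerance 1992, Lemma 2.10.** Let `Δ` be a negative discriminant
(`Δ < 0`, `Δ ≡ 0, 1 (mod 4)`) and `a` an integer with `1 ≤ a ≤ ½√|Δ|` (i.e. `4a² ≤ |Δ|`) all of
whose prime factors `p` belong to `𝒫_Δ = {p : (Δ/p) = 1}` — spelled out per LP92 (2.6)–(2.7):
`Δ ≡ 1 (mod 8)` if `2 ∣ a`, and `p ∤ Δ`, `Δ` a square mod `p` for the odd `p`. Then there exist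
`b, c ∈ ℤ` such that `(a, b, c) ∈ C_Δ`, i.e. `(a, b, c)` is a reduced primitive positive definite
form of discriminant `Δ` (`reducedForms Δ`). [cite: LenstraPomerance1992, §2 Lemma 2.10 (p. 489)] -/
theorem exists_mem_reducedForms_fst_eq {Δ : ℤ} (hΔ : Δ < 0) (h4 : Δ % 4 = 0 ∨ Δ % 4 = 1)
    {a : ℕ} (ha : 0 < a) (hale : 4 * a ^ 2 ≤ Δ.natAbs) (h2 : 2 ∣ a → Δ % 8 = 1)
    (hodd : ∀ p ∈ a.primeFactors, p ≠ 2 → ¬ (p : ℤ) ∣ Δ ∧ ∃ x : ℤ, (p : ℤ) ∣ x ^ 2 - Δ) :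
    ∃ b c : ℤ, ((a : ℤ), b, c) ∈ reducedForms Δ := by
  have hDΔ : ((Δ.natAbs : ℕ) : ℤ) = -Δ := Int.ofNat_natAbs_of_nonpos hΔ.le
  have haleZ : 4 * (a : ℤ) ^ 2 ≤ -Δ := by rw [← hDΔ]; exact_mod_cast hale
  -- Step 1: `b₀² ≡ Δ (mod 4a)`
  obtain ⟨b₀, hb₀⟩ := exists_sq_sub_dvd_four_mul h4 ha h2 hodd
  push_cast at hb₀
  -- Step 2: shift into `(-a, a]`: `b = a - ((a - b₀) mod 2a)`
  set r : ℤ := (a - b₀) % (2 * a) with hr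
  have hr0 : 0 ≤ r := Int.emod_nonneg _ (by positivity)
  have hr2 : r < 2 * a := Int.emod_lt_of_pos _ (by positivity)
  set t : ℤ := (a - b₀) / (2 * a) with ht'
  have ht : (a : ℤ) - b₀ - r = 2 * a * t := by
    have := Int.emod_add_mul_ediv ((a : ℤ) - b₀) (2 * a)
    rw [← hr, ← ht'] at this
    linear_combination -this
  set b : ℤ := a - r with hb
  have hbb₀ : b - b₀ = 2 * a * t := by rw [hb]; linear_combination ht
  -- Step 3: `4a ∣ b² - Δ`
  have h4ab : (4 * (a : ℤ)) ∣ b ^ 2 - Δ := by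
    have : b ^ 2 - Δ = (b₀ ^ 2 - Δ) + 4 * a * (t * (a * t + b₀)) := by
      have hb' : b = b₀ + 2 * a * t := by linear_combination hbb₀
      rw [hb']; ring
    rw [this]
    exact dvd_add hb₀ (dvd_mul_right _ _)
  obtain ⟨c, hc⟩ := h4ab
  -- the form `(a, b, c)`
  refine ⟨b, c, (mem_reducedForms_iff hΔ).2 ⟨?_, by simp only; exact_mod_cast ha, ?_, ?_⟩⟩
  · rw [discr_apply]; linear_combination hc
  · -- primitive: a prime `q ∣ a, q ∣ b` would divide `Δ = b² - 4ac`, but `q ∈ 𝒫_Δ`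
    rw [isPrimitive_iff, Int.gcd_eq_natAbs, Int.gcd_eq_natAbs, Int.natAbs_natCast,
      Int.natAbs_natCast]
    suffices hab : Nat.Coprime a b.natAbs by rw [hab.gcd_eq_one, Nat.gcd_one_left]
    refine Nat.coprime_of_dvd fun q hq hqa hqb => ?_
    have hqaZ : (q : ℤ) ∣ a := Int.natCast_dvd_natCast.2 hqa
    have hqbZ : (q : ℤ) ∣ b := Int.natCast_dvd.2 hqb
    have hqΔ : (q : ℤ) ∣ Δ := by
      have : Δ = b * b - 4 * a * c := by linear_combination -hc
      rw [this]
      exact dvd_sub (dvd_mul_of_dvd_left hqbZ _)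
        (dvd_mul_of_dvd_left (dvd_mul_of_dvd_right hqaZ _) _)
    have hqmem : q ∈ a.primeFactors := Nat.mem_primeFactors.2 ⟨hq, hqa, ha.ne'⟩
    by_cases hq2 : q = 2
    · subst hq2
      have h8 := h2 hqa
      omega
    · exact (hodd q hqmem hq2).1 hqΔ
  · -- reduced: `-a < b ≤ a ≤ c`, and `a = c` forces `b = 0`
    have hac : (a : ℤ) ≤ c := by nlinarith
    refine ⟨by simp only; omega, by simp only; omega, by simp only; exact hac, ?_⟩
    simp only
    rintro (h | h | h)
    · omega
    · omega
    · rw [← h] at hc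
      nlinarith

end Literature.NumberTheory.QuadraticFields.BinaryQuadraticForm
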